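import Summits.CriticalPhenomena.Ising3DConformalLimit.Theorems.HyperoctahedralRPLimitRotationInvariantQuarterTurnDefs
import Literature.MathematicalPhysics.QuantumFieldTheory.MirrorRPKernel
import Summits.CriticalPhenomena.Ising3DConformalLimit.Theorems.HyperoctahedralRPCriticalCorrNineMirrorRP
import Summits.CriticalPhenomena.Ising3DConformalLimit.Theorems.HyperoctahedralRPInversionUpgradeNormalisedOSReflectionPositive
import HarnessLib

/-!
# Nine-mirror reflection positivity of a normalised scaling limit of the critical `ℤ³` Ising
# correlators: stub `stub_nineMirrorRP` (S1b) of line `quarter-turn-liouville` for crux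
# `HyperoctahedralRP.LimitRotationInvariant` (stmt-CriticalPhenomena-1980)

Statement.  Every candidate limit `(ρ, Δ, S)` satisfying the crux hypotheses `CruxHyp ρ Δ S` (`ρ > 0` on
`(0,1]`, `S` the pointwise scaling limit of `criticalCorr 3` under `ρ`, `S = 0` off `NonCoincident`,
non-degenerate two-point function, translation invariance, scale covariance) is reflection positive in
each of the nine lattice mirrors `n^⊥`, `n ∈ latticeMirrorNormals (Fin 3)` (`e_i`, `e_i ± e_j`), in the
pointwise Osterwalder–Schrader sense `MirrorRP n S`: for finitely many finite clusters `x^a` in the open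
half-space `⟪·, n⟫ > 0` and reals `c_a`, `Σ_{a,b} c_a c_b S(θ_n x^a ⊔ x^b) ≥ 0`.

Proof (transfer of the landed lattice input `HyperoctahedralRPNineMirror.criticalCorrNineMirrorRP_proof`
by the HALF-MESH SHIFT of `FreeEndpointGaussianClosure.stub_osReflectionPositive`).
* The continuum reflections are the lattice site mirrors read in real coordinates: `θ_{e_i}` negates the
  coordinate `i`, `θ_{e_i - e_j}` swaps `i, j`, `θ_{e_i + e_j}` is `x_i ↦ -x_j, x_j ↦ -x_i`
  (`reflection_single_apply` & co.).
* Non-injective clusters are dropped: replacing `c_a` by `c_a · [x^a injective]` changes neither side,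
  since a term with a non-injective cluster has a non-injective appended configuration, on which `S`
  vanishes (normalisation); for injective clusters in the open half-space `θ_n x^a ⊔ x^b` IS injective
  (`⟪θ_n p, n⟫ = -⟪p, n⟫`).
* Mesh transfer with the shift `s(δ) = (δ/2) w`, `w = e_i`, `e_i + e_j`, `0` respectively: for `δ` off the
  countable set where some `p_l/δ + ½` is an integer, `[(θ_n p + s(δ))/δ] = θ_lattice [(p + s(δ))/δ]`
  EXACTLY (`⌊-u + ½⌋ = -⌊u + ½⌋`, `floor_neg_add_half`; the swap commutes with the coordinatewise floor
  for every `δ`), and the lattice level `ℓ` of `[(p + s(δ))/δ]` is `> 0` for all `δ < ⟪p, n⟫`.  The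
  lattice inequality with coefficients `c_a ρ(δ)^{k_a}` is positivity of the shifted rescaled double sum.
* Limit: `S(config + s(δ)) = S(config)` (translation invariance) and locally uniform convergence at the
  moving injective configuration (`tendsto_of_tendstoLocallyUniformlyOn_of_apply_eq`); the good meshes
  are frequent in `𝓝[>] 0` (`Set.Countable.dense_compl`), and `ge_of_tendsto_of_frequently` concludes.

References: K. Osterwalder, R. Schrader, Comm. Math. Phys. 31 (1973) 83–112, (E2); J. Glimm, A. Jaffe,
*Quantum Physics* (2nd ed. 1987), §6.1; J. Fröhlich, R. Israel, E. H. Lieb, B. Simon, Comm. Math. Phys.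
62 (1978) 1–34, §3 Thm. 3.1 (reflection positivity in diagonal site planes).
No definitions are introduced: the line's vocabulary (`CruxHyp`, `refl`, `MirrorRP`, `NineMirrorRP`) is
imported from `…Theorems.HyperoctahedralRPLimitRotationInvariantQuarterTurnDefs`.
-/

noncomputable section

open scoped BigOperators
open Filter Topology
open Literature.Probability.LatticeModels
open Literature.MathematicalPhysics.QuantumFieldTheory
open Summit.CriticalPhenomena.Ising3DConformalLimit.Cruxes.InversionUpgradeNormalised.FreeEndpointGaussianClosure

namespace Summit.CriticalPhenomena.Ising3DConformalLimit.Cruxes.LimitRotationInvariant.QuarterTurnLiouville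

/-! ### Injectivity of appended configurations -/

/-- An appended tuple `Fin.append u v` is injective iff both parts are injective with disjoint values.
[folklore] -/
theorem injective_fin_append_iff {α : Type*} {m n : ℕ} (u : Fin m → α) (v : Fin n → α) :
    Function.Injective (Fin.append u v) ↔
      Function.Injective u ∧ Function.Injective v ∧ ∀ i j, u i ≠ v j := by
  constructor
  · intro h
    refine ⟨fun i i' hii' => ?_, fun j j' hjj' => ?_, fun i j hij => ?_⟩
    · have h' : Fin.append u v (Fin.castAdd n i) = Fin.append u v (Fin.castAdd n i') := by
        simpa only [Fin.append_left] using hii'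
      exact Fin.castAdd_injective _ _ (h h')
    · have h' : Fin.append u v (Fin.natAdd m j) = Fin.append u v (Fin.natAdd m j') := by
        simpa only [Fin.append_right] using hjj'
      exact Fin.natAdd_injective _ _ (h h')
    · have h' : Fin.append u v (Fin.castAdd n i) = Fin.append u v (Fin.natAdd m j) := by
        simpa only [Fin.append_left, Fin.append_right] using hij
      have h2 := congrArg Fin.val (h h')
      simp only [Fin.val_castAdd, Fin.val_natAdd] at h2
      omega
  · rintro ⟨hu, hv, huv⟩ p q hpq
    induction p using Fin.addCases with
    | left i =>
      induction q using Fin.addCases with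
      | left i' => rw [Fin.append_left, Fin.append_left] at hpq; rw [hu hpq]
      | right j' => rw [Fin.append_left, Fin.append_right] at hpq; exact absurd hpq (huv i j')
    | right j =>
      induction q using Fin.addCases with
      | left i' => rw [Fin.append_right, Fin.append_left] at hpq; exact absurd hpq.symm (huv i' j)
      | right j' => rw [Fin.append_right, Fin.append_right] at hpq; rw [hv hpq]

/-! ### The transfer lemma: lattice mirror positivity passes to the limit -/

/-- **RP transfer by the half-mesh shift.**  Let `S` be a normalised, translation-invariant pointwise
scaling limit of `criticalCorr 3`.  Suppose a continuum map `θc` (injective, flipping the `n`-component),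
a lattice map `θl` with an integer level `ℓ`, and a shift direction `w` satisfy: lattice reflection
positivity of `criticalCorr 3` for `(θl, ℓ)` on `{ℓ > 0}`; exact intertwining
`[(θc p + (δ/2) w)/δ] = θl [(p + (δ/2) w)/δ]` whenever no `p_l/δ + ½` is an integer; and eventual
positivity of the level of `[(p + (δ/2) w)/δ]` as `δ → 0⁺` for `⟪p, n⟫ > 0`.  Then `S` is reflection
positive for `θc` over clusters in `{⟪·, n⟫ > 0}`. [folklore] -/
theorem sum_sum_mul_limit_nonneg_of_latticeMirrorRP {ρ : ℝ → ℝ} {S : CorrFamily 3}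
    (hlim : HasPointwiseScalingLimit (criticalCorr 3) ρ S)
    (hnorm : ∀ n z, z ∉ NonCoincident 3 n → S n z = 0) (htr : IsTranslationInvariant S)
    (n : EuclideanSpace ℝ (Fin 3)) (θc : EuclideanSpace ℝ (Fin 3) → EuclideanSpace ℝ (Fin 3))
    (hθinj : Function.Injective θc) (hθn : ∀ p, inner ℝ (θc p) n = -inner ℝ p n)
    (θl : Site 3 → Site 3) (ℓ : Site 3 → ℤ) (w : EuclideanSpace ℝ (Fin 3))
    (hRP : ∀ (m : ℕ) (k : Fin m → ℕ) (z : (a : Fin m) → Fin (k a) → Site 3) (c : Fin m → ℝ),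
      (∀ a i, 0 < ℓ (z a i)) →
      0 ≤ ∑ a, ∑ b, c a * c b *
        criticalCorr 3 (k a + k b) (Fin.append (fun i => θl (z a i)) (z b)))
    (happrox : ∀ (p : EuclideanSpace ℝ (Fin 3)) (δ : ℝ), 0 < δ →
      (∀ (l : Fin 3) (z : ℤ), p l / δ + 1 / 2 ≠ z) →
      latticeApprox δ (θc p + (δ / 2) • w) = θl (latticeApprox δ (p + (δ / 2) • w)))
    (hlevel : ∀ p : EuclideanSpace ℝ (Fin 3), 0 < inner ℝ p n →
      ∀ᶠ δ in 𝓝[>] (0 : ℝ), 0 < ℓ (latticeApprox δ (p + (δ / 2) • w)))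
    (m : ℕ) (k : Fin m → ℕ) (x : (a : Fin m) → Fin (k a) → EuclideanSpace ℝ (Fin 3))
    (c : Fin m → ℝ) (hx : ∀ a i, 0 < inner ℝ (x a i) n) :
    0 ≤ ∑ a, ∑ b, c a * c b * S (k a + k b) (Fin.append (fun i => θc (x a i)) (x b)) := by
  classical
  -- injectivity of the appended configurations
  have hZinj : ∀ a b, Function.Injective (Fin.append (fun i => θc (x a i)) (x b)) ↔
      (Function.Injective (x a) ∧ Function.Injective (x b)) := by
    intro a b
    rw [injective_fin_append_iff]
    constructor
    · rintro ⟨ha, hb, -⟩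
      exact ⟨fun i i' h => ha (congrArg θc h : θc (x a i) = θc (x a i')), hb⟩
    · rintro ⟨ha, hb⟩
      refine ⟨hθinj.comp ha, hb, fun i j hij => ?_⟩
      have h1 := hx a i
      have h2 := hx b j
      rw [← hij, hθn] at h2
      linarith
  -- drop the non-injective clusters
  set c' : Fin m → ℝ := fun a => if Function.Injective (x a) then c a else 0 with hc'
  have hsum : ∑ a, ∑ b, c a * c b * S (k a + k b) (Fin.append (fun i => θc (x a i)) (x b)) =
      ∑ a, ∑ b, c' a * c' b * S (k a + k b) (Fin.append (fun i => θc (x a i)) (x b)) := by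
    refine Finset.sum_congr rfl fun a _ => Finset.sum_congr rfl fun b _ => ?_
    by_cases hab : Function.Injective (x a) ∧ Function.Injective (x b)
    · simp only [hc', if_pos hab.1, if_pos hab.2]
    · have h0 : S (k a + k b) (Fin.append (fun i => θc (x a i)) (x b)) = 0 :=
        hnorm _ _ fun h => hab ((hZinj a b).1 h)
      simp only [h0, mul_zero]
  rw [hsum]
  -- the half-mesh shift `(δ/2) w → 0`
  have hv : Tendsto (fun δ : ℝ => (δ / 2) • w) (𝓝[>] 0) (𝓝 0) := by
    have hc : Continuous fun δ : ℝ => (δ / 2) • w :=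
      (continuous_id.div_const 2).smul continuous_const
    simpa using (hc.tendsto 0).mono_left nhdsWithin_le_nhds
  -- (1) the shifted double sum tends to the dropped OS form
  have hlimΦ : Tendsto (fun δ : ℝ => ∑ a, ∑ b, c' a * c' b *
      rescaledCorrelator (criticalCorr 3) ρ (k a + k b) δ
        (fun l => Fin.append (fun i => θc (x a i)) (x b) l + (δ / 2) • w))
      (𝓝[>] 0) (𝓝 (∑ a, ∑ b, c' a * c' b *
        S (k a + k b) (Fin.append (fun i => θc (x a i)) (x b)))) := by
    refine tendsto_finsetSum _ fun a _ => tendsto_finsetSum _ fun b _ => ?_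
    by_cases hab : Function.Injective (x a) ∧ Function.Injective (x b)
    · refine Tendsto.const_mul _ ?_
      have hZab : Fin.append (fun i => θc (x a i)) (x b) ∈ NonCoincident 3 (k a + k b) :=
        (hZinj a b).2 hab
      have hg : Tendsto (fun δ : ℝ => fun l => Fin.append (fun i => θc (x a i)) (x b) l + (δ / 2) • w)
          (𝓝[>] 0) (𝓝[NonCoincident 3 (k a + k b)] (Fin.append (fun i => θc (x a i)) (x b))) := by
        refine tendsto_nhdsWithin_iff.2
          ⟨tendsto_pi_nhds.2 fun l => ?_, Eventually.of_forall fun δ => ?_⟩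
        · simpa using hv.const_add (Fin.append (fun i => θc (x a i)) (x b) l)
        · exact (add_left_injective _).comp hZab
      exact tendsto_of_tendstoLocallyUniformlyOn_of_apply_eq (hlim _) hZab hg fun δ => htr _ _ _
    · have h0 : c' a * c' b = 0 := by
        rcases not_and_or.1 hab with h | h
        · simp only [hc', if_neg h, zero_mul]
        · simp only [hc', if_neg h, mul_zero]
      simp only [h0, zero_mul]
      exact tendsto_const_nhds
  -- (2) positivity of the shifted double sum off the countable bad set, once the levels are positive
  set Bad : Set ℝ := Set.range fun q : ((Σ a : Fin m, Fin (k a)) × Fin 3) × ℤ =>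
    x q.1.1.1 q.1.1.2 q.1.2 / ((q.2 : ℝ) - 1 / 2)
  have hBad : Bad.Countable := Set.countable_range _
  have hgood : ∀ δ : ℝ, 0 < δ → δ ∉ Bad →
      (∀ a i, 0 < ℓ (latticeApprox δ (x a i + (δ / 2) • w))) →
      0 ≤ ∑ a, ∑ b, c' a * c' b *
        rescaledCorrelator (criticalCorr 3) ρ (k a + k b) δ
          (fun l => Fin.append (fun i => θc (x a i)) (x b) l + (δ / 2) • w) := by
    intro δ hδ hδB hℓ
    -- `δ` is good: no `p_l/δ + ½` is an integer
    have hfrac : ∀ (a : Fin m) (i : Fin (k a)) (l : Fin 3) (z : ℤ), x a i l / δ + 1 / 2 ≠ z := by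
      intro a i l z hz
      refine hδB (Set.mem_range.2 ⟨(⟨⟨a, i⟩, l⟩, z), ?_⟩)
      have hz0 : (z : ℝ) - 1 / 2 ≠ 0 := by
        intro h0
        have h1 : (2 * z : ℤ) = 1 := by exact_mod_cast (by linarith : (2 * z : ℝ) = 1)
        omega
      have h1 : x a i l / δ = z - 1 / 2 := by linarith
      rw [div_eq_iff hδ.ne'] at h1
      change x a i l / ((z : ℝ) - 1 / 2) = δ
      rw [div_eq_iff hz0, h1, mul_comm]
    -- the shifted lattice configurations and the exact mirror symmetry
    set zz : (a : Fin m) → Fin (k a) → Site 3 :=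
      fun a i => latticeApprox δ (x a i + (δ / 2) • w)
    have hcfg : ∀ a b : Fin m,
        (fun l => latticeApprox δ (Fin.append (fun i => θc (x a i)) (x b) l + (δ / 2) • w)) =
          Fin.append (fun i => θl (zz a i)) (zz b) := by
      intro a b
      change (fun q => latticeApprox δ (q + (δ / 2) • w)) ∘ Fin.append _ _ = _
      rw [comp_fin_append]
      refine congrArg₂ Fin.append (funext fun i => ?_) rfl
      exact happrox (x a i) δ hδ (hfrac a i)
    -- the lattice inequality with coefficients `c'_a ρ(δ)^{k_a}`
    have key : 0 ≤ ∑ a, ∑ b, (c' a * ρ δ ^ k a) * (c' b * ρ δ ^ k b) *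
        criticalCorr 3 (k a + k b) (Fin.append (fun i => θl (zz a i)) (zz b)) :=
      hRP m k zz (fun a => c' a * ρ δ ^ k a) hℓ
    refine key.trans_eq (Finset.sum_congr rfl fun a _ => Finset.sum_congr rfl fun b _ => ?_)
    rw [rescaledCorrelator_apply, hcfg a b, pow_add]
    ring
  -- (3) conclusion: good small meshes are frequent in `𝓝[>] 0`
  have hfreq : ∃ᶠ δ in 𝓝[>] (0 : ℝ), δ ∉ Bad := by
    rw [Filter.frequently_iff]
    intro U hU
    obtain ⟨u, hu, hsub⟩ := mem_nhdsGT_iff_exists_Ioo_subset.1 hU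
    obtain ⟨δ, hδB, hδu⟩ :=
      (hBad.dense_compl ℝ).exists_mem_open isOpen_Ioo (Set.nonempty_Ioo.2 hu)
    exact ⟨δ, hsub hδu, hδB⟩
  have hev : ∀ᶠ δ in 𝓝[>] (0 : ℝ),
      δ ∈ Set.Ioi (0 : ℝ) ∧ ∀ a i, 0 < ℓ (latticeApprox δ (x a i + (δ / 2) • w)) :=
    eventually_mem_nhdsWithin.and
      (eventually_all.2 fun a => eventually_all.2 fun i => hlevel (x a i) (hx a i))
  refine ge_of_tendsto_of_frequently hlimΦ ?_
  exact (hfreq.and_eventually hev).mono fun δ ⟨hδB, hδ, hℓ⟩ => hgood δ hδ hδB hℓ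

/-! ### The three mirror families: intertwining with the site mirrors, positivity of the levels -/

/-- `θ_{e_i}` is the axis reflection `θ_i` (negation of the coordinate `i`). [folklore] -/
theorem refl_single_eq_axisReflection (i : Fin 3) (p : EuclideanSpace ℝ (Fin 3)) :
    refl (EuclideanSpace.single i 1) p = axisReflection i p := by
  ext l
  rw [reflection_single_apply, axisReflection_apply]

/-- Axis mirrors `e_i` (shift direction `e_i`): off the half-integers the shifted approximation
intertwines `θ_{e_i}` with the site mirror `k ↦ update k i (-k_i)`. [folklore] -/
theorem latticeApprox_refl_single (i : Fin 3) (p : EuclideanSpace ℝ (Fin 3)) {δ : ℝ} (hδ : 0 < δ)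
    (hp : ∀ (l : Fin 3) (z : ℤ), p l / δ + 1 / 2 ≠ z) :
    latticeApprox δ (refl (EuclideanSpace.single i 1) p + (δ / 2) • EuclideanSpace.single i (1 : ℝ)) =
      Function.update (latticeApprox δ (p + (δ / 2) • EuclideanSpace.single i (1 : ℝ))) i
        (-(latticeApprox δ (p + (δ / 2) • EuclideanSpace.single i (1 : ℝ)) i)) := by
  rw [refl_single_eq_axisReflection]
  exact latticeApprox_axisReflection_add_halfMesh i p hδ.ne' (hp i)

/-- Axis mirrors `e_i`: the level `k_i` of the shifted approximation of a point with `p_i > 0` is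
positive for `0 < δ < p_i`. [folklore] -/
theorem eventually_level_single (i : Fin 3) {p : EuclideanSpace ℝ (Fin 3)}
    (hp : 0 < inner ℝ p (EuclideanSpace.single i (1 : ℝ))) :
    ∀ᶠ δ in 𝓝[>] (0 : ℝ),
      0 < latticeApprox δ (p + (δ / 2) • EuclideanSpace.single i (1 : ℝ)) i := by
  rw [real_inner_comm, inner_single_one_left] at hp
  filter_upwards [Ioo_mem_nhdsGT hp] with δ hδ
  simp only [latticeApprox_apply, PiLp.add_apply, PiLp.smul_apply, PiLp.single_eq_same, smul_eq_mul,
    mul_one]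
  rw [Int.floor_pos, le_div_iff₀ hδ.1]
  linarith [hδ.2]

/-- Anti-diagonal mirrors `e_i + e_j` (shift direction `e_i + e_j`): off the half-integers the shifted
approximation intertwines `θ_{e_i + e_j}` (`x_i ↦ -x_j`, `x_j ↦ -x_i`) with the corresponding site
mirror. [folklore] -/
theorem latticeApprox_refl_single_add_single {i j : Fin 3} (hij : i ≠ j)
    (p : EuclideanSpace ℝ (Fin 3)) {δ : ℝ} (hδ : 0 < δ)
    (hp : ∀ (l : Fin 3) (z : ℤ), p l / δ + 1 / 2 ≠ z) :
    latticeApprox δ (refl (EuclideanSpace.single i 1 + EuclideanSpace.single j 1) p +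
        (δ / 2) • (EuclideanSpace.single i (1 : ℝ) + EuclideanSpace.single j 1)) =
      Function.update (Function.update
        (latticeApprox δ (p + (δ / 2) • (EuclideanSpace.single i (1 : ℝ) + EuclideanSpace.single j 1)))
        i (-(latticeApprox δ
          (p + (δ / 2) • (EuclideanSpace.single i (1 : ℝ) + EuclideanSpace.single j 1)) j)))
        j (-(latticeApprox δ
          (p + (δ / 2) • (EuclideanSpace.single i (1 : ℝ) + EuclideanSpace.single j 1)) i)) := by
  have hδ0 : δ ≠ 0 := hδ.ne'
  have hdiv : ∀ u : ℝ, (u + δ / 2) / δ = u / δ + 1 / 2 := fun u => by field_simp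
  have hdiv' : ∀ u : ℝ, (-u + δ / 2) / δ = -(u / δ) + 1 / 2 := fun u => by field_simp
  funext l
  rcases eq_or_ne l j with hlj | hlj
  · rw [hlj]
    simp only [Function.update_self, latticeApprox_apply, PiLp.add_apply, PiLp.smul_apply,
      PiLp.single_apply, reflection_single_add_single_apply hij, smul_eq_mul, hij, hij.symm, if_true,
      if_false, zero_add, add_zero, mul_one]
    rw [hdiv', hdiv]
    exact floor_neg_add_half (hp i)
  · rcases eq_or_ne l i with hli | hli
    · rw [hli]
      simp only [Function.update_of_ne hij, Function.update_self, latticeApprox_apply, PiLp.add_apply,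
        PiLp.smul_apply, PiLp.single_apply, reflection_single_add_single_apply hij, smul_eq_mul, hij,
        hij.symm, if_true, if_false, zero_add, add_zero, mul_one]
      rw [hdiv', hdiv]
      exact floor_neg_add_half (hp j)
    · simp only [Function.update_of_ne hlj, Function.update_of_ne hli, latticeApprox_apply,
        PiLp.add_apply, PiLp.smul_apply, PiLp.single_apply, reflection_single_add_single_apply hij,
        smul_eq_mul, hli, hlj, if_false, add_zero, mul_zero]

/-- Anti-diagonal mirrors `e_i + e_j`: the level `k_i + k_j` of the shifted approximation of a point with
`p_i + p_j > 0` is positive for `0 < δ < p_i + p_j`. [folklore] -/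
theorem eventually_level_single_add_single {i j : Fin 3} (hij : i ≠ j) {p : EuclideanSpace ℝ (Fin 3)}
    (hp : 0 < inner ℝ p (EuclideanSpace.single i (1 : ℝ) + EuclideanSpace.single j 1)) :
    ∀ᶠ δ in 𝓝[>] (0 : ℝ),
      0 < latticeApprox δ (p + (δ / 2) • (EuclideanSpace.single i (1 : ℝ) + EuclideanSpace.single j 1)) i +
        latticeApprox δ (p + (δ / 2) • (EuclideanSpace.single i (1 : ℝ) + EuclideanSpace.single j 1)) j := by
  rw [real_inner_comm, inner_single_add_single_left] at hp
  filter_upwards [Ioo_mem_nhdsGT hp] with δ hδ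
  simp only [latticeApprox_apply, PiLp.add_apply, PiLp.smul_apply, PiLp.single_apply, smul_eq_mul, hij,
    hij.symm, if_true, if_false, add_zero, zero_add, mul_one]
  have hδ0 : δ ≠ 0 := hδ.1.ne'
  have h1 := Int.lt_floor_add_one ((p i + δ / 2) / δ)
  have h2 := Int.lt_floor_add_one ((p j + δ / 2) / δ)
  have h3 : (p i + δ / 2) / δ + (p j + δ / 2) / δ = (p i + p j) / δ + 1 := by
    field_simp
    ring
  have h4 : 1 < (p i + p j) / δ := by
    rw [lt_div_iff₀ hδ.1]
    linarith [hδ.2]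
  have h5 : (0 : ℝ) < ⌊(p i + δ / 2) / δ⌋ + ⌊(p j + δ / 2) / δ⌋ := by linarith
  exact_mod_cast h5

/-- Diagonal mirrors `e_i - e_j` (no shift): the approximation intertwines `θ_{e_i - e_j}` (swap of the
coordinates `i, j`) with the lattice swap, for every mesh. [folklore] -/
theorem latticeApprox_refl_single_sub_single {i j : Fin 3} (hij : i ≠ j)
    (p : EuclideanSpace ℝ (Fin 3)) (δ : ℝ) :
    latticeApprox δ (refl (EuclideanSpace.single i 1 - EuclideanSpace.single j 1) p +
        (δ / 2) • (0 : EuclideanSpace ℝ (Fin 3))) =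
      latticeApprox δ (p + (δ / 2) • (0 : EuclideanSpace ℝ (Fin 3))) ∘ Equiv.swap i j := by
  funext l
  simp only [smul_zero, add_zero, Function.comp_apply, latticeApprox_apply,
    reflection_single_sub_single_apply hij]

/-- Diagonal mirrors `e_i - e_j`: the level `k_i - k_j` of the approximation of a point with
`p_i - p_j > 0` is positive for `0 < δ < p_i - p_j`. [folklore] -/
theorem eventually_level_single_sub_single {i j : Fin 3} {p : EuclideanSpace ℝ (Fin 3)}
    (hp : 0 < inner ℝ p (EuclideanSpace.single i (1 : ℝ) - EuclideanSpace.single j 1)) :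
    ∀ᶠ δ in 𝓝[>] (0 : ℝ),
      0 < latticeApprox δ (p + (δ / 2) • (0 : EuclideanSpace ℝ (Fin 3))) i -
        latticeApprox δ (p + (δ / 2) • (0 : EuclideanSpace ℝ (Fin 3))) j := by
  rw [real_inner_comm, inner_single_sub_single_left] at hp
  filter_upwards [Ioo_mem_nhdsGT hp] with δ hδ
  simp only [smul_zero, add_zero, latticeApprox_apply]
  have h1 := Int.lt_floor_add_one (p i / δ)
  have h2 := Int.floor_le (p j / δ)
  have h4 : 1 < p i / δ - p j / δ := by
    rw [← sub_div, lt_div_iff₀ hδ.1]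
    linarith [hδ.2]
  have h5 : (0 : ℝ) < ⌊p i / δ⌋ - ⌊p j / δ⌋ := by linarith
  exact_mod_cast h5

/-! ### The registered stub -/

/-- **S1b · `stub_nineMirrorRP`.**  Nine-mirror reflection positivity of a normalised limit, transferred
from the landed lattice input `HyperoctahedralRPNineMirror.criticalCorrNineMirrorRP_proof` (site mirrors
through `0`, strict `ℓ > 0`): drop the non-injective clusters (their terms vanish on both sides by
normalisation), shift every point by the half-mesh vector `(δ/2)(e_i [+ e_j])` so that
`latticeApprox δ ∘ θ_n = θ_lattice ∘ latticeApprox δ` EXACTLY for `δ` off a countable set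
(`⌊-w + 1/2⌋ = -⌊w + 1/2⌋` off the half-integers; no shift for the swap mirrors `e_i - e_j`), note
`ℓ > 0` eventually as `δ → 0⁺`, and pass to the limit along the moving configurations
(`tendsto_of_tendstoLocallyUniformlyOn_of_apply_eq`, translation invariance) frequently in `𝓝[>] 0`
(`Set.Countable.dense_compl`, `ge_of_tendsto_of_frequently`). -/
theorem stub_nineMirrorRP :
    ∀ (ρ : ℝ → ℝ) (Δ : ℝ) (S : CorrFamily 3), CruxHyp ρ Δ S → NineMirrorRP S := by
  rintro ρ Δ S ⟨-, hlim, hnorm, -, htr, -⟩ n hn m k x c hx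
  have hθinj : Function.Injective (refl n) := ((ℝ ∙ n)ᗮ).reflection.injective
  have hθn : ∀ p, inner ℝ (refl n p) n = -inner ℝ p n := fun p => inner_mirrorReflection_normal n p
  obtain ⟨i, j, hij, rfl | rfl | rfl⟩ := hn
  · -- axis mirror `e_i`: site mirror `k ↦ update k i (-k_i)`, level `k_i`, shift direction `e_i`
    exact sum_sum_mul_limit_nonneg_of_latticeMirrorRP hlim hnorm htr _ _ hθinj hθn
      (fun y : Site 3 => Function.update y i (-y i)) (fun y : Site 3 => y i)
      (EuclideanSpace.single i (1 : ℝ))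
      (HyperoctahedralRPNineMirror.criticalCorrNineMirrorRP_proof
        (fun y : Site 3 => Function.update y i (-y i)) (fun y : Site 3 => y i)
        ⟨i, j, hij, Or.inl ⟨rfl, rfl⟩⟩)
      (fun p δ hδ hp => latticeApprox_refl_single i p hδ hp)
      (fun p hp => eventually_level_single i hp) m k x c hx
  · -- anti-diagonal mirror `e_i + e_j`: `k_i ↦ -k_j, k_j ↦ -k_i`, level `k_i + k_j`, shift `e_i + e_j`
    exact sum_sum_mul_limit_nonneg_of_latticeMirrorRP hlim hnorm htr _ _ hθinj hθn
      (fun y : Site 3 => Function.update (Function.update y i (-y j)) j (-y i))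
      (fun y : Site 3 => y i + y j) (EuclideanSpace.single i (1 : ℝ) + EuclideanSpace.single j 1)
      (HyperoctahedralRPNineMirror.criticalCorrNineMirrorRP_proof
        (fun y : Site 3 => Function.update (Function.update y i (-y j)) j (-y i))
        (fun y : Site 3 => y i + y j) ⟨i, j, hij, Or.inr (Or.inr ⟨rfl, rfl⟩)⟩)
      (fun p δ hδ hp => latticeApprox_refl_single_add_single hij p hδ hp)
      (fun p hp => eventually_level_single_add_single hij hp) m k x c hx
  · -- diagonal mirror `e_i - e_j`: swap of `k_i, k_j`, level `k_i - k_j`, no shift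
    exact sum_sum_mul_limit_nonneg_of_latticeMirrorRP hlim hnorm htr _ _ hθinj hθn
      (fun y : Site 3 => y ∘ Equiv.swap i j) (fun y : Site 3 => y i - y j)
      (0 : EuclideanSpace ℝ (Fin 3))
      (HyperoctahedralRPNineMirror.criticalCorrNineMirrorRP_proof
        (fun y : Site 3 => y ∘ Equiv.swap i j) (fun y : Site 3 => y i - y j)
        ⟨i, j, hij, Or.inr (Or.inl ⟨rfl, rfl⟩)⟩)
      (fun p δ _ _ => latticeApprox_refl_single_sub_single hij p δ)
      (fun p hp => eventually_level_single_sub_single hp) m k x c hx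

end Summit.CriticalPhenomena.Ising3DConformalLimit.Cruxes.LimitRotationInvariant.QuarterTurnLiouville

end
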